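import Mathlib.Analysis.SpecialFunctions.Pow.Asymptotics
import Mathlib.Analysis.SpecialFunctions.Pow.Real
import Mathlib.Analysis.SpecialFunctions.Sqrt
import HarnessLib

/-!
# Luo–Titi's parameter curve (Luo–Titi 2020, §3.1, (3.21))

Analysis/FluidPDE support file (everything proved; no named facts; pure real analysis) for the
proof of the Iteration Lemma of T. Luo and E. S. Titi, Calc. Var. PDE 59 (2020) =
arXiv:1808.07595 (`Torus.LuoTiti2020_iterationLemma`). §3.1: "we introduce several parameters
`σ, r, λ, μ` … Later `σ, r, μ` will be chosen to be suitable powers of `λ_{q+1}`. We also fix a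
constant `p > 1` which will be chosen later to be close to `1`"; (3.21): "Finally, we fix `α` and
`p` such that … `r = λ^α`, `σ = λ^{-(α+1)/2}`, `μ = λ^{(5α+1)/4}` … The Iteration Lemma holds by
taking `λ_{q+1}` sufficiently large." For the jet-based realisation of the scheme
(`LuoTitiPerturbation`, parameters `μ` (transverse concentration = frequency), `κ` (axial
concentration), `σ ∈ ℕ` (cell frequency), `μ′` (temporal frequency), `p`), this file fixes the
curve
  `κ = μ^{1-a}`, `σ = ⌈μ^b⌉`, `μ′ = μ^{(1-a)/2 + 1 + c}`, `p = 1 + g/64`,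
  `a = g`, `b = c = g/4`, `g = 5/2 - 2θ ∈ (0, 1/2]` (the gap to Lions' exponent `5/4`),
and proves that every size entering the `L¹` bounds of the new stress and of the increment tends
to `0` as `μ → ∞` (`tendsto_*`): the `L¹` smallness of the intermittent principal part
(`κ^{-1/2}μ⁻¹`), of the correctors (`κ^{1/2}μ⁻²`, `κ²μ⁻²`, `μ′⁻²κμ²`, `μ′⁻¹`, `σ⁻¹`), of the
time-derivative term `ℛ∂ₜ(w^{(p)}+w^{(c)})` (`σμ′ · σ⁻¹κ^{3/2-1/p}μ^{-2/p}`, which forces `a > c`),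
and of the hyperviscous term `ℛ(ν(-Δ)^θ w)` in `sup × |supp|^{1/p}` form
(`(κ⁻¹μ⁻²)^{1/p} (σκ^{1/2}μ²)^{2-θ} (σ³κ^{1/2}μ⁴)^{θ-1} = σ^{2θ-1}κ^{1/2-1/p}μ^{2θ-2/p}`, exponent
`2θ - 5/2 + a/2 + b(2θ-1) + O(p-1) < 0` iff `θ < 5/4` for small `a, b, p - 1`: (3.20)).

## References

* T. Luo, E. S. Titi, Calc. Var. PDE 59 (2020) = arXiv:1808.07595, §3.1, §3.5 (3.20)–(3.21). [`LuoTiti2020`]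
-/

noncomputable section

open Filter Topology Set

namespace Literature.Analysis.FluidPDE

namespace LuoTiti

namespace Param

/-! ## The curve -/

/-- Axial concentration `κ = μ^{1-a}`. [cite: LuoTiti2020, §3.1] -/
def κf (a μ : ℝ) : ℝ := μ ^ (1 - a)

/-- Cell frequency `σ = ⌈μ^b⌉ ∈ ℕ`. [cite: LuoTiti2020, §3.1] -/
def σf (b μ : ℝ) : ℕ := ⌈μ ^ b⌉₊

/-- The exponent `(1-a)/2 + 1 + c` of the temporal frequency. [folklore] -/
def mexp (a c : ℝ) : ℝ := (1 - a) / 2 + 1 + c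

/-- Temporal frequency `μ′ = μ^{(1-a)/2 + 1 + c}` (`= κ^{1/2} μ^{1+c}`). [cite: LuoTiti2020, §3.1] -/
def mupf (a c μ : ℝ) : ℝ := μ ^ mexp a c

section Basic

variable {a b c μ : ℝ}

/-- Positivity and the basic comparisons on the curve (`μ ≥ 1`, `0 ≤ a ≤ 1`, `0 ≤ b`, `0 ≤ c`).
[folklore] -/
theorem curve_basic (ha0 : 0 ≤ a) (ha1 : a ≤ 1) (hb : 0 ≤ b) (hc : 0 ≤ c) (hμ : 1 ≤ μ) :
    0 < κf a μ ∧ 1 ≤ κf a μ ∧ κf a μ ≤ μ ∧ 0 < σf b μ ∧ μ ^ b ≤ (σf b μ : ℝ) ∧ (σf b μ : ℝ) ≤ 2 * μ ^ b ∧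
      0 < mupf a c μ ∧ Real.sqrt (κf a μ) * μ ≤ mupf a c μ := by
  have hμ0 : 0 < μ := zero_lt_one.trans_le hμ
  have h1 : 1 ≤ κf a μ := Real.one_le_rpow hμ (by linarith)
  have h2 : κf a μ ≤ μ := by
    unfold κf
    calc μ ^ (1 - a) ≤ μ ^ (1 : ℝ) := Real.rpow_le_rpow_of_exponent_le hμ (by linarith)
      _ = μ := Real.rpow_one μ
  have hb1 : 1 ≤ μ ^ b := Real.one_le_rpow hμ hb
  have h3 : μ ^ b ≤ (σf b μ : ℝ) := Nat.le_ceil _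
  have h4 : 0 < σf b μ := Nat.ceil_pos.2 (zero_lt_one.trans_le hb1)
  have h5 : (σf b μ : ℝ) ≤ 2 * μ ^ b := by
    have := Nat.ceil_lt_add_one (zero_le_one.trans hb1)
    unfold σf; linarith
  have h6 : 0 < mupf a c μ := Real.rpow_pos_of_pos hμ0 _
  have h7 : Real.sqrt (κf a μ) * μ ≤ mupf a c μ := by
    unfold κf mupf mexp
    rw [Real.sqrt_eq_rpow, ← Real.rpow_mul hμ0.le]
    calc μ ^ ((1 - a) * (1 / 2)) * μ = μ ^ ((1 - a) * (1 / 2) + 1) := by rw [Real.rpow_add hμ0, Real.rpow_one]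
      _ ≤ μ ^ ((1 - a) / 2 + 1 + c) := Real.rpow_le_rpow_of_exponent_le hμ (by linarith)
  exact ⟨zero_lt_one.trans_le h1, h1, h2, h4, h3, h5, h6, h7⟩

/-- **The monomial bound on the curve**: for `μ ≥ 1`,
`κ^α σ^β (μ′)^γ μ^δ ≤ 2^{|β|} μ^{(1-a)α + bβ + ((1-a)/2+1+c)γ + δ}`. [folklore] -/
theorem monomial_le (ha0 : 0 ≤ a) (ha1 : a ≤ 1) (hb : 0 ≤ b) (hc : 0 ≤ c) (hμ : 1 ≤ μ) (α β γ δ : ℝ) :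
    κf a μ ^ α * ((σf b μ : ℝ)) ^ β * mupf a c μ ^ γ * μ ^ δ ≤ (2 : ℝ) ^ |β| * μ ^ ((1 - a) * α + b * β + mexp a c * γ + δ) := by
  obtain ⟨hκ0, -, -, hσ0, hσ1, hσ2, hm0, -⟩ := curve_basic ha0 ha1 hb hc hμ
  have hμ0 : 0 < μ := zero_lt_one.trans_le hμ
  have hb0 : 0 < μ ^ b := Real.rpow_pos_of_pos hμ0 _
  have hσ0' : (0 : ℝ) < σf b μ := by exact_mod_cast hσ0
  have e1 : κf a μ ^ α = μ ^ ((1 - a) * α) := by unfold κf; rw [← Real.rpow_mul hμ0.le]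
  have e3 : mupf a c μ ^ γ = μ ^ (mexp a c * γ) := by unfold mupf; rw [← Real.rpow_mul hμ0.le]
  have e2 : ((σf b μ : ℝ)) ^ β ≤ (2 : ℝ) ^ |β| * μ ^ (b * β) := by
    rcases le_or_gt 0 β with hβ | hβ
    · calc ((σf b μ : ℝ)) ^ β ≤ (2 * μ ^ b) ^ β := Real.rpow_le_rpow hσ0'.le hσ2 hβ
        _ = (2 : ℝ) ^ |β| * μ ^ (b * β) := by rw [Real.mul_rpow (by norm_num) hb0.le, ← Real.rpow_mul hμ0.le, abs_of_nonneg hβ]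
    · calc ((σf b μ : ℝ)) ^ β ≤ (μ ^ b) ^ β := Real.rpow_le_rpow_of_nonpos hb0 hσ1 hβ.le
        _ = 1 * μ ^ (b * β) := by rw [← Real.rpow_mul hμ0.le, one_mul]
        _ ≤ (2 : ℝ) ^ |β| * μ ^ (b * β) :=
            mul_le_mul_of_nonneg_right (Real.one_le_rpow (by norm_num) (abs_nonneg β)) (Real.rpow_nonneg hμ0.le _)
  have p1 : 0 ≤ μ ^ ((1 - a) * α) := Real.rpow_nonneg hμ0.le _
  have p3 : 0 ≤ μ ^ (mexp a c * γ) := Real.rpow_nonneg hμ0.le _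
  have p4 : 0 ≤ μ ^ δ := Real.rpow_nonneg hμ0.le _
  rw [e1, e3]
  calc μ ^ ((1 - a) * α) * ((σf b μ : ℝ)) ^ β * μ ^ (mexp a c * γ) * μ ^ δ
      ≤ μ ^ ((1 - a) * α) * ((2 : ℝ) ^ |β| * μ ^ (b * β)) * μ ^ (mexp a c * γ) * μ ^ δ := by gcongr
    _ = (2 : ℝ) ^ |β| * (μ ^ ((1 - a) * α) * μ ^ (b * β) * μ ^ (mexp a c * γ) * μ ^ δ) := by ring
    _ = (2 : ℝ) ^ |β| * μ ^ ((1 - a) * α + b * β + mexp a c * γ + δ) := by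
        rw [Real.rpow_add hμ0, Real.rpow_add hμ0, Real.rpow_add hμ0]

/-- Squeeze to zero from a bound valid for `μ ≥ 1`. [folklore] -/
theorem tendsto_zero_of_abs_le {f g : ℝ → ℝ} (hg : Tendsto g atTop (𝓝 0)) (h : ∀ μ, 1 ≤ μ → |f μ| ≤ g μ) :
    Tendsto f atTop (𝓝 0) :=
  squeeze_zero_norm' (by filter_upwards [eventually_ge_atTop (1 : ℝ)] with μ hμ; rw [Real.norm_eq_abs]; exact h μ hμ) hg

/-- **Monomials with negative total exponent tend to zero along the curve.** [folklore] -/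
theorem tendsto_monomial (ha0 : 0 ≤ a) (ha1 : a ≤ 1) (hb : 0 ≤ b) (hc : 0 ≤ c) {α β γ δ : ℝ}
    (he : (1 - a) * α + b * β + mexp a c * γ + δ < 0) (C : ℝ) :
    Tendsto (fun μ => C * (κf a μ ^ α * ((σf b μ : ℝ)) ^ β * mupf a c μ ^ γ * μ ^ δ)) atTop (𝓝 0) := by
  have hlim : Tendsto (fun μ : ℝ => |C| * ((2 : ℝ) ^ |β| * μ ^ ((1 - a) * α + b * β + mexp a c * γ + δ))) atTop (𝓝 0) := by
    have h1 := tendsto_rpow_neg_atTop (y := -((1 - a) * α + b * β + mexp a c * γ + δ)) (by linarith)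
    rw [neg_neg] at h1
    have := (h1.const_mul ((2 : ℝ) ^ |β|)).const_mul |C|
    simpa using this
  refine tendsto_zero_of_abs_le hlim fun μ hμ => ?_
  obtain ⟨hκ0, -, -, hσ0, -, -, hm0, -⟩ := curve_basic ha0 ha1 hb hc hμ
  have hμ0 : 0 < μ := zero_lt_one.trans_le hμ
  have hσ0' : (0 : ℝ) < σf b μ := by exact_mod_cast hσ0
  have hnn : 0 ≤ κf a μ ^ α * ((σf b μ : ℝ)) ^ β * mupf a c μ ^ γ * μ ^ δ := by positivity
  rw [abs_mul, abs_of_nonneg hnn]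
  exact mul_le_mul_of_nonneg_left (monomial_le ha0 ha1 hb hc hμ α β γ δ) (abs_nonneg C)

end Basic

/-! ## The exponents of Luo–Titi's scheme -/

/-- The gap `g = 5/2 - 2θ` to Lions' exponent. [cite: LuoTiti2020, §1 (θ < 5/4)] -/
def gap (θ : ℝ) : ℝ := 5 / 2 - 2 * θ

/-- The integrability exponent `p = 1 + g/64`. [cite: LuoTiti2020, §3.1 ("`p > 1` … close to `1`")] -/
def pexp (θ : ℝ) : ℝ := 1 + gap θ / 64

/-- `κ`, `σ`, `μ′` of the scheme as functions of `μ`: `a = g`, `b = c = g/4`. [cite: LuoTiti2020, §3.5 (3.21)] -/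
def κθ (θ μ : ℝ) : ℝ := κf (gap θ) μ

/-- `σ` of the scheme, see `κθ`. [cite: LuoTiti2020, §3.5 (3.21)] -/
def σθ (θ μ : ℝ) : ℕ := σf (gap θ / 4) μ

/-- `μ′` of the scheme, see `κθ`. [cite: LuoTiti2020, §3.5 (3.21)] -/
def mupθ (θ μ : ℝ) : ℝ := mupf (gap θ) (gap θ / 4) μ

section Scheme

variable {θ : ℝ} (hθ1 : 1 ≤ θ) (hθ2 : θ < 5 / 4)
include hθ1 hθ2

/-- `0 < g ≤ 1/2`, `1 < p ≤ 2`, `1/p ≥ 1 - g/64`. [folklore] -/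
theorem gap_bounds : 0 < gap θ ∧ gap θ ≤ 1 / 2 ∧ 1 < pexp θ ∧ pexp θ ≤ 2 ∧ 1 - gap θ / 64 ≤ 1 / pexp θ ∧ 1 / pexp θ ≤ 1 := by
  have g0 : 0 < gap θ := by unfold gap; linarith
  have g1 : gap θ ≤ 1 / 2 := by unfold gap; linarith
  have p1 : 1 < pexp θ := by unfold pexp; linarith
  have p2 : pexp θ ≤ 2 := by unfold pexp; linarith
  refine ⟨g0, g1, p1, p2, ?_, ?_⟩
  · rw [le_div_iff₀ (by linarith), pexp]
    nlinarith
  · rw [div_le_one (by linarith)]; exact p1.le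

/-- The curve of the scheme is admissible: `μ ≥ 1 ⇒ 1 ≤ κ ≤ μ`, `μ^{g/4} ≤ σ ≤ 2μ^{g/4}`, `κ^{1/2}μ ≤ μ′`. [folklore] -/
theorem scheme_basic {μ : ℝ} (hμ : 1 ≤ μ) :
    0 < κθ θ μ ∧ 1 ≤ κθ θ μ ∧ κθ θ μ ≤ μ ∧ 0 < σθ θ μ ∧ μ ^ (gap θ / 4) ≤ (σθ θ μ : ℝ) ∧ (σθ θ μ : ℝ) ≤ 2 * μ ^ (gap θ / 4) ∧
      0 < mupθ θ μ ∧ Real.sqrt (κθ θ μ) * μ ≤ mupθ θ μ := by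
  obtain ⟨g0, g1, -, -, -, -⟩ := gap_bounds hθ1 hθ2
  exact curve_basic g0.le (by linarith) (by linarith) (by linarith) hμ

/-- The monomial limit, specialised to the scheme. [folklore] -/
theorem tendsto_monomial' {α β γ δ : ℝ} (he : (1 - gap θ) * α + gap θ / 4 * β + mexp (gap θ) (gap θ / 4) * γ + δ < 0) (C : ℝ) :
    Tendsto (fun μ => C * (κθ θ μ ^ α * ((σθ θ μ : ℝ)) ^ β * mupθ θ μ ^ γ * μ ^ δ)) atTop (𝓝 0) := by
  obtain ⟨g0, g1, -, -, -, -⟩ := gap_bounds hθ1 hθ2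
  exact tendsto_monomial g0.le (by linarith) (by linarith) (by linarith) he C

/-! ## The sizes of the scheme tend to zero -/

/-- `C σ⁻¹ → 0` (oscillation tensor, oscillation remainder, amplitude floor correction). [cite: LuoTiti2020, §3.5 (3.21)] -/
theorem tendsto_inv_σ (C : ℝ) : Tendsto (fun μ => C * ((σθ θ μ : ℝ))⁻¹) atTop (𝓝 0) := by
  obtain ⟨g0, g1, -, -, -, -⟩ := gap_bounds hθ1 hθ2
  have h := tendsto_monomial' hθ1 hθ2 (α := 0) (β := -1) (γ := 0) (δ := 0) (by simp only [mexp]; nlinarith) C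
  refine h.congr' ?_
  filter_upwards [eventually_ge_atTop (1 : ℝ)] with μ hμ
  obtain ⟨hκ0, -, -, hσ0, -, -, hm0, -⟩ := scheme_basic hθ1 hθ2 hμ
  rw [Real.rpow_zero, Real.rpow_zero, Real.rpow_zero, Real.rpow_neg_one]; ring

/-- `C μ′⁻¹ → 0` (slow-time source `f₃`). [folklore] -/
theorem tendsto_inv_mup (C : ℝ) : Tendsto (fun μ => C * (mupθ θ μ)⁻¹) atTop (𝓝 0) := by
  obtain ⟨g0, g1, -, -, -, -⟩ := gap_bounds hθ1 hθ2
  have h := tendsto_monomial' hθ1 hθ2 (α := 0) (β := 0) (γ := -1) (δ := 0) (by simp only [mexp]; nlinarith) C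
  refine h.congr' ?_
  filter_upwards [eventually_ge_atTop (1 : ℝ)] with μ hμ
  rw [Real.rpow_zero, Real.rpow_zero, Real.rpow_zero, Real.rpow_neg_one]; ring

/-- `C κ^{-1/2}μ⁻¹ → 0` (the `L¹` norm of the intermittent principal part). [cite: LuoTiti2020, §3.4 (3.15)] -/
theorem tendsto_Lp (C : ℝ) : Tendsto (fun μ => C * (κθ θ μ ^ (-(1 / 2 : ℝ)) * μ⁻¹)) atTop (𝓝 0) := by
  obtain ⟨g0, g1, -, -, -, -⟩ := gap_bounds hθ1 hθ2
  have h := tendsto_monomial' hθ1 hθ2 (α := -(1 / 2)) (β := 0) (γ := 0) (δ := -1) (by simp only [mexp]; nlinarith) C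
  refine h.congr' ?_
  filter_upwards [eventually_ge_atTop (1 : ℝ)] with μ hμ
  rw [Real.rpow_zero, Real.rpow_zero, Real.rpow_neg_one]; ring

/-- `C κ^{1/2}μ⁻² → 0` and `C κ²μ⁻² → 0` (the `L¹` norm of the corrector `w^{(c)}`, and
`sup‖w^{(c)}‖ · ‖w^{(c)}‖_{L¹}`; the second needs `a > 0`). [folklore] -/
theorem tendsto_Lc (C : ℝ) : Tendsto (fun μ => C * (κθ θ μ ^ (1 / 2 : ℝ) * μ ^ (-(2 : ℝ)))) atTop (𝓝 0) ∧
    Tendsto (fun μ => C * (κθ θ μ ^ (2 : ℝ) * μ ^ (-(2 : ℝ)))) atTop (𝓝 0) := by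
  obtain ⟨g0, g1, -, -, -, -⟩ := gap_bounds hθ1 hθ2
  constructor
  · have h := tendsto_monomial' hθ1 hθ2 (α := 1 / 2) (β := 0) (γ := 0) (δ := -2) (by simp only [mexp]; nlinarith) C
    refine h.congr' ?_
    filter_upwards [eventually_ge_atTop (1 : ℝ)] with μ hμ
    rw [Real.rpow_zero, Real.rpow_zero]; ring
  · have h := tendsto_monomial' hθ1 hθ2 (α := 2) (β := 0) (γ := 0) (δ := -2) (by simp only [mexp]; nlinarith) C
    refine h.congr' ?_
    filter_upwards [eventually_ge_atTop (1 : ℝ)] with μ hμ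
    rw [Real.rpow_zero, Real.rpow_zero]; ring

/-- `C (μ′⁻¹)² κ μ² → 0` (the `L²` norm of the temporal corrector; needs `c > 0`). [folklore] -/
theorem tendsto_EX (C : ℝ) : Tendsto (fun μ => C * (((mupθ θ μ)⁻¹) ^ 2 * (κθ θ μ * μ ^ 2))) atTop (𝓝 0) := by
  obtain ⟨g0, g1, -, -, -, -⟩ := gap_bounds hθ1 hθ2
  have h := tendsto_monomial' hθ1 hθ2 (α := 1) (β := 0) (γ := -2) (δ := 2) (by simp only [mexp]; nlinarith) C
  refine h.congr' ?_
  filter_upwards [eventually_ge_atTop (1 : ℝ)] with μ hμ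
  obtain ⟨hκ0, -, -, hσ0, -, -, hm0, -⟩ := scheme_basic hθ1 hθ2 hμ
  have hμ0 : 0 < μ := zero_lt_one.trans_le hμ
  rw [Real.rpow_zero, Real.rpow_one, Real.rpow_two, Real.rpow_neg hm0.le, Real.rpow_two, inv_pow]; ring

/-- **The time-derivative term** `ℛ∂ₜ(w^{(p)} + w^{(c)})`: `C σ⁻¹κ^{1/2-1/p}μ^{-2/p} → 0` and
`C σμ′ · σ⁻¹κ^{3/2-1/p}μ^{-2/p} → 0` (the latter needs `a > c + O(p-1)`).
[cite: LuoTiti2020, §3.5 (3.18)] -/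
theorem tendsto_Lf₁ (C : ℝ) :
    Tendsto (fun μ => C * (((σθ θ μ : ℝ))⁻¹ * κθ θ μ ^ (1 / 2 - 1 / pexp θ) * μ ^ (-(2 / pexp θ)))) atTop (𝓝 0) ∧
    Tendsto (fun μ => C * ((σθ θ μ : ℝ) * mupθ θ μ * (((σθ θ μ : ℝ))⁻¹ * κθ θ μ ^ (3 / 2 - 1 / pexp θ) * μ ^ (-(2 / pexp θ)))))
      atTop (𝓝 0) := by
  obtain ⟨g0, g1, p1, p2, ip1, ip2⟩ := gap_bounds hθ1 hθ2
  constructor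
  · have he : (1 - gap θ) * (1 / 2 - 1 / pexp θ) + gap θ / 4 * (-1) + mexp (gap θ) (gap θ / 4) * 0 + (-(2 / pexp θ)) < 0 := by
      simp only [mexp]
      have : 2 / pexp θ = 2 * (1 / pexp θ) := by ring
      rw [this]; nlinarith
    have h := tendsto_monomial' hθ1 hθ2 he C
    refine h.congr' ?_
    filter_upwards [eventually_ge_atTop (1 : ℝ)] with μ hμ
    rw [Real.rpow_zero, Real.rpow_neg_one]; ring
  · have he : (1 - gap θ) * (3 / 2 - 1 / pexp θ) + gap θ / 4 * 0 + mexp (gap θ) (gap θ / 4) * 1 + (-(2 / pexp θ)) < 0 := by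
      simp only [mexp]
      have : 2 / pexp θ = 2 * (1 / pexp θ) := by ring
      rw [this]; nlinarith
    have h := tendsto_monomial' hθ1 hθ2 he C
    refine h.congr' ?_
    filter_upwards [eventually_ge_atTop (1 : ℝ)] with μ hμ
    obtain ⟨hκ0, -, -, hσ0, -, -, hm0, -⟩ := scheme_basic hθ1 hθ2 hμ
    have hσ0' : (0 : ℝ) < σθ θ μ := by exact_mod_cast hσ0
    rw [Real.rpow_zero, Real.rpow_one]
    field_simp

/-- **The hyperviscous term** `ℛ(ν(-Δ)^θ w)` in `sup × |supp|^{1/p}` form: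
`C (κ⁻¹μ⁻²)^{1/p} (σκ^{1/2}μ²)^{2-θ} (σ³κ^{1/2}μ⁴)^{θ-1} → 0` — total exponent
`2θ - 5/2 + a/2 + b(2θ-1) + O(p-1) < 0` exactly because `θ < 5/4`. [cite: LuoTiti2020, §3.5 (3.20)] -/
theorem tendsto_Hν (C : ℝ) :
    Tendsto (fun μ => C * (((κθ θ μ)⁻¹ * μ ^ (-(2 : ℝ))) ^ (1 / pexp θ) *
      (((σθ θ μ : ℝ) * κθ θ μ ^ (1 / 2 : ℝ) * μ ^ (2 : ℝ)) ^ (2 - θ) * (((σθ θ μ : ℝ)) ^ (3 : ℝ) * κθ θ μ ^ (1 / 2 : ℝ) * μ ^ (4 : ℝ)) ^ (θ - 1))))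
      atTop (𝓝 0) := by
  obtain ⟨g0, g1, p1, p2, ip1, ip2⟩ := gap_bounds hθ1 hθ2
  -- the exponents
  set q : ℝ := 1 / pexp θ with hq
  set α : ℝ := -q + (1 / 2) * (2 - θ) + (1 / 2) * (θ - 1) with hα
  set β : ℝ := (2 - θ) + 3 * (θ - 1) with hβ
  set δ : ℝ := -2 * q + 2 * (2 - θ) + 4 * (θ - 1) with hδ
  have he : (1 - gap θ) * α + gap θ / 4 * β + mexp (gap θ) (gap θ / 4) * 0 + δ < 0 := by
    simp only [mexp, hα, hβ, hδ]
    have hg : gap θ = 5 / 2 - 2 * θ := rfl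
    nlinarith
  have h := tendsto_monomial' hθ1 hθ2 he C
  refine h.congr' ?_
  filter_upwards [eventually_ge_atTop (1 : ℝ)] with μ hμ
  obtain ⟨hκ0, -, -, hσ0, -, -, hm0, -⟩ := scheme_basic hθ1 hθ2 hμ
  have hμ0 : 0 < μ := zero_lt_one.trans_le hμ
  have hσ0' : (0 : ℝ) < σθ θ μ := by exact_mod_cast hσ0
  set κ := κθ θ μ
  set σ : ℝ := (σθ θ μ : ℝ)
  rw [Real.rpow_zero, mul_one]
  -- expand the right-hand side into the monomial
  have e1 : (κ⁻¹ * μ ^ (-(2 : ℝ))) ^ q = κ ^ (-q) * μ ^ (-2 * q) := by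
    rw [Real.mul_rpow (inv_nonneg.2 hκ0.le) (Real.rpow_nonneg hμ0.le _), Real.inv_rpow hκ0.le, ← Real.rpow_neg hκ0.le,
      ← Real.rpow_mul hμ0.le]
  have e2 : (σ * κ ^ (1 / 2 : ℝ) * μ ^ (2 : ℝ)) ^ (2 - θ) = σ ^ (2 - θ) * κ ^ ((1 / 2) * (2 - θ)) * μ ^ (2 * (2 - θ)) := by
    rw [Real.mul_rpow (by positivity) (Real.rpow_nonneg hμ0.le _), Real.mul_rpow hσ0'.le (Real.rpow_nonneg hκ0.le _),
      ← Real.rpow_mul hκ0.le, ← Real.rpow_mul hμ0.le]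
  have e3 : (σ ^ (3 : ℝ) * κ ^ (1 / 2 : ℝ) * μ ^ (4 : ℝ)) ^ (θ - 1) = σ ^ (3 * (θ - 1)) * κ ^ ((1 / 2) * (θ - 1)) * μ ^ (4 * (θ - 1)) := by
    rw [Real.mul_rpow (by positivity) (Real.rpow_nonneg hμ0.le _), Real.mul_rpow (Real.rpow_nonneg hσ0'.le _) (Real.rpow_nonneg hκ0.le _),
      ← Real.rpow_mul hκ0.le, ← Real.rpow_mul hμ0.le, ← Real.rpow_mul hσ0'.le]
  rw [e1, e2, e3]
  have eκ : κ ^ (-q) * κ ^ ((1 / 2) * (2 - θ)) * κ ^ ((1 / 2) * (θ - 1)) = κ ^ α := by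
    rw [hα, Real.rpow_add hκ0, Real.rpow_add hκ0]
  have eσ : σ ^ (2 - θ) * σ ^ (3 * (θ - 1)) = σ ^ β := by rw [hβ, Real.rpow_add hσ0']
  have eμ : μ ^ (-2 * q) * μ ^ (2 * (2 - θ)) * μ ^ (4 * (θ - 1)) = μ ^ δ := by
    rw [hδ, Real.rpow_add hμ0, Real.rpow_add hμ0]
  calc C * (κ ^ α * σ ^ β * μ ^ δ) = C * ((κ ^ (-q) * κ ^ ((1 / 2) * (2 - θ)) * κ ^ ((1 / 2) * (θ - 1))) *
      (σ ^ (2 - θ) * σ ^ (3 * (θ - 1))) * (μ ^ (-2 * q) * μ ^ (2 * (2 - θ)) * μ ^ (4 * (θ - 1)))) := by rw [eκ, eσ, eμ]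
    _ = _ := by ring

end Scheme

end Param

end LuoTiti

end Literature.Analysis.FluidPDE
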